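import Literature.AlgebraicTopology.KTheory.SphereSmash
import Literature.AlgebraicTopology.KTheory.BottSurj
import Literature.AlgebraicTopology.KTheory.ClutchingStablyTrivial
import HarnessLib

/-!
# `K̃(X ∧ Y) = 0` from a Künneth decomposition; `K̃(S²ᵐ⁺¹) = 0`

The passage from the product form of complex Bott periodicity ("`K⁰(X × S²)` is generated over
`K⁰(X)` by `1` and the Bott class `γ = [θ¹, z]`": `bott_surjective`, `BottSurj.lean`; Husemöller,
*Fibre Bundles*, Ch. 11 §1 and Thm. 5.1; Hatcher, *Vector Bundles and K-Theory*, Thm. 2.2) to the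
vanishing of the reduced `K`-groups of odd spheres (Husemöller, Ch. 11 Thm. 5.5: `K̃(S²ᵐ⁺¹) = 0`;
Hatcher, Cor. 2.12). Only the *generation* half of periodicity is needed, first abstractly for an
element `η ∈ K⁰(Y)` of rank one:

* §1 `kunneth_decomp_eq_zero` — if `K̃(X, x₀) = 0`, `rank_{y₀} η = 1`, and
  `a = pr₁^* α + pr₁^* β · pr₂^* η ∈ K⁰(X × Y)` vanishes on both slices `X × {y₀}`, `{x₀} × Y`,
  then `a = 0`: the first slice gives `α = -β`, `K̃(X) = 0` gives `β = k · 1`, so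
  `a = pr₂^*(k (η - 1))`, and the second slice gives `k (η - 1) = 0`;
* §2 `reduced_collapse_prodWedge_eq_bot_of_decomp` — hence `K̃((X × Y)/(X ∨ Y)) = 0` whenever
  every class on `X × Y` decomposes as `pr₁^* α + pr₁^* β · pr₂^* η` (injectivity of `q^*`,
  `WedgeCollapse.lean`);
* §3 `reduced_sphere_add_two_eq_bot_of_decomp`, `reduced_sphere_odd_eq_bot_of_decomp` — the
  induction `K̃(S¹) = 0 ⟹ K̃(S³) = 0 ⟹ ⋯` along `Sᵖ ∧ S² ≅ Sᵖ⁺²` (`SphereSmash.lean`), modulo the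
  decomposition of `K⁰(Sᵖ × S²)` over `1` and `pr₂^* η` for a rank-one class `η ∈ K⁰(S²)`;
* §4 the Bott inputs: `rankAt_bottClassGL` (`[θ, g]` has rank `n` everywhere), naturality
  `pullback_baseMap_bottγ : (f × id)^* γ_X = γ_{X'}`, the class `γ₀ = j^* γ_{pt} ∈ K⁰(S²)` with
  `pr₂^* γ₀ = γ_X` (`pullback_snd_bottγ_unit`) and rank one, and
  **`reduced_sphere_odd_eq_bot : K̃(S²ᵐ⁺¹) = 0`**, `reduced_sphere_seven_eq_bot` (at the pole),
  from `bott_surjective`.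

Everything is proved; no named facts.

## References

* D. Husemöller, *Fibre Bundles*, 3rd ed., GTM 20 (1994), Ch. 11 §1 (Cor. 1.4), Thm. 5.1,
  Thm. 5.5. [HusemollerFibreBundles1994]
* A. Hatcher, *Vector Bundles and K-Theory* (v2.2, 2017), §2.1 Thm. 2.2, p. 55, Cor. 2.12. [HatcherVBKT2017]
* R. Bott, *The stable homotopy of the classical groups*, Ann. of Math. (2) 70 (1959), 313–337, §1
  (`π_{2m}(U) = 0`, equivalently `K̃(S²ᵐ⁺¹) = 0`). [Bott1959]
-/

noncomputable section

namespace Literature.AlgebraicTopology.KTheory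

open Literature.RingTheory.KTheory Set Metric TopologicalSpace

universe u v

/-! ### 1. Classes `pr₁^* α + pr₁^* β · pr₂^* η` vanishing on both slices -/

section Decomp

variable {X : Type u} {Y : Type v} [TopologicalSpace X] [TopologicalSpace Y]

/-- `pr₁ ∘ (x ↦ (x, y₀)) = id`. [folklore] -/
theorem fst_comp_sliceLeft (y₀ : Y) :
    ContinuousMap.fst.comp ((ContinuousMap.id X).prodMk (ContinuousMap.const X y₀)) = ContinuousMap.id X := by
  ext; rfl

/-- `pr₁ ∘ (y ↦ (x₀, y)) = const x₀`. [folklore] -/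
theorem fst_comp_sliceRight (x₀ : X) :
    ContinuousMap.fst.comp ((ContinuousMap.const Y x₀).prodMk (ContinuousMap.id Y)) = ContinuousMap.const Y x₀ := by
  ext; rfl

/-- `pr₂ ∘ (x ↦ (x, y₀)) = const y₀`. [folklore] -/
theorem snd_comp_sliceLeft (y₀ : Y) :
    ContinuousMap.snd.comp ((ContinuousMap.id X).prodMk (ContinuousMap.const X y₀)) = ContinuousMap.const X y₀ := by
  ext; rfl

/-- `pr₂ ∘ (y ↦ (x₀, y)) = id`. [folklore] -/
theorem snd_comp_sliceRight (x₀ : X) :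
    ContinuousMap.snd.comp ((ContinuousMap.const Y x₀).prodMk (ContinuousMap.id Y)) = ContinuousMap.id Y := by
  ext; rfl

/-- Restriction of `pr₁^* α` to the slice `X × {y₀}` is `α`. [folklore] -/
theorem pullback_sliceLeft_pullback_fst (y₀ : Y) (α : K0 X) :
    pullback ((ContinuousMap.id X).prodMk (ContinuousMap.const X y₀)) (pullback ContinuousMap.fst α) = α := by
  rw [← AddMonoidHom.comp_apply, ← pullback_comp, fst_comp_sliceLeft, pullback_id, AddMonoidHom.id_apply]

/-- Restriction of `pr₁^* α` to the slice `{x₀} × Y` is the constant `rank_{x₀}(α)`. [folklore] -/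
theorem pullback_sliceRight_pullback_fst (x₀ : X) (α : K0 X) :
    pullback ((ContinuousMap.const Y x₀).prodMk (ContinuousMap.id Y)) (pullback ContinuousMap.fst α) =
      KZero.unitHom _ (rankAt x₀ α) := by
  rw [← AddMonoidHom.comp_apply, ← pullback_comp, fst_comp_sliceRight, pullback_const]

/-- Restriction of `pr₂^* η` to the slice `X × {y₀}` is the constant `rank_{y₀}(η)`. [folklore] -/
theorem pullback_sliceLeft_pullback_snd (y₀ : Y) (η : K0 Y) :
    pullback ((ContinuousMap.id X).prodMk (ContinuousMap.const X y₀)) (pullback ContinuousMap.snd η) =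
      KZero.unitHom _ (rankAt y₀ η) := by
  rw [← AddMonoidHom.comp_apply, ← pullback_comp, snd_comp_sliceLeft, pullback_const]

/-- Restriction of `pr₂^* η` to the slice `{x₀} × Y` is `η`. [folklore] -/
theorem pullback_sliceRight_pullback_snd (x₀ : X) (η : K0 Y) :
    pullback ((ContinuousMap.const Y x₀).prodMk (ContinuousMap.id Y)) (pullback ContinuousMap.snd η) = η := by
  rw [← AddMonoidHom.comp_apply, ← pullback_comp, snd_comp_sliceRight, pullback_id, AddMonoidHom.id_apply]

/-- If `K̃(X, x₀) = 0`, every class is the constant `rank_{x₀}`. [cite: HusemollerEtAl2008, Ch. 4 Rem. 2.6] -/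
theorem eq_unitHom_rankAt_of_reduced_eq_bot {x₀ : X} (hX : Reduced X x₀ = ⊥) (β : K0 X) :
    β = KZero.unitHom _ (rankAt x₀ β) := by
  have h := sub_unitHom_rankAt_mem_reduced x₀ β
  rw [hX, AddSubgroup.mem_bot, sub_eq_zero] at h
  exact h

/-- **A Künneth-decomposed class vanishing on both slices is zero.** Let `K̃(X, x₀) = 0` and let
`η ∈ K⁰(Y)` have rank `1` at `y₀`. If `a = pr₁^* α + pr₁^* β · pr₂^* η` restricts to `0` on
`X × {y₀}` and on `{x₀} × Y`, then `a = 0`: the first slice gives `α = -β`; as `K̃(X) = 0`,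
`β = k · 1` with `k = rank_{x₀} β`, so `a = pr₂^* (k (η - 1))`, and the second slice gives
`k (η - 1) = 0`. [cite: HatcherVBKT2017, §2.1 p. 55] -/
theorem kunneth_decomp_eq_zero (x₀ : X) (y₀ : Y) (hX : Reduced X x₀ = ⊥) (η : K0 Y) (hη : rankAt y₀ η = 1) (α β : K0 X)
    (hL : pullback ((ContinuousMap.id X).prodMk (ContinuousMap.const X y₀))
      (pullback ContinuousMap.fst α + pullback ContinuousMap.fst β * pullback ContinuousMap.snd η) = 0)
    (hR : pullback ((ContinuousMap.const Y x₀).prodMk (ContinuousMap.id Y))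
      (pullback ContinuousMap.fst α + pullback ContinuousMap.fst β * pullback ContinuousMap.snd η) = 0) :
    pullback ContinuousMap.fst α + pullback ContinuousMap.fst β * pullback ContinuousMap.snd η = 0 := by
  -- first slice: `α + β = 0`
  rw [map_add, pullback_mul, pullback_sliceLeft_pullback_fst, pullback_sliceLeft_pullback_fst,
    pullback_sliceLeft_pullback_snd, hη, unitHom_eq_intCast, Int.cast_one, mul_one] at hL
  have hα : α = -β := eq_neg_of_add_eq_zero_left hL
  -- `β = k • 1`, so `a = pr₂^* (k (η - 1))`
  set k := rankAt x₀ β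
  have hβ : β = KZero.unitHom _ k := eq_unitHom_rankAt_of_reduced_eq_bot hX β
  have ha : pullback ContinuousMap.fst α + pullback ContinuousMap.fst β * pullback ContinuousMap.snd η =
      pullback (ContinuousMap.snd : C(X × Y, Y)) (KZero.unitHom _ k * (η - 1)) := by
    rw [hα, map_neg, hβ, pullback_unitHom, pullback_mul, pullback_unitHom, map_sub, pullback_one, mul_sub, mul_one]
    abel
  -- second slice: `k (η - 1) = 0`
  rw [ha, ← AddMonoidHom.comp_apply, ← pullback_comp, snd_comp_sliceRight, pullback_id, AddMonoidHom.id_apply] at hR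
  rw [ha, hR, map_zero]

end Decomp

/-! ### 2. `K̃((X × Y)/(X ∨ Y)) = 0` -/

section Collapse

variable {X : Type u} {Y : Type v} [TopologicalSpace X] [TopologicalSpace Y] [T1Space X] [T1Space Y]

/-- **`K̃((X × Y)/(X ∨ Y)) = 0` from a Künneth decomposition.** If `K̃(X, x₀) = 0`, `η ∈ K⁰(Y)` has
rank `1` at `y₀`, and every class on `X × Y` is of the form `pr₁^* α + pr₁^* β · pr₂^* η`, then the
reduced `K`-group of the smash `(X × Y)/(X ∨ Y)` at its base point vanishes: a reduced class pulls
back to a class on `X × Y` vanishing on both slices (`pullback_sliceLeft/Right_quotK`), hence to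
`0` (`kunneth_decomp_eq_zero`), hence is `0` (`eq_zero_of_quotK_prodWedge_eq_zero`).
[cite: HatcherVBKT2017, §2.1 p. 55] -/
theorem reduced_collapse_prodWedge_eq_bot_of_decomp (x₀ : X) (y₀ : Y) (hX : Reduced X x₀ = ⊥) (η : K0 Y)
    (hη : rankAt y₀ η = 1)
    (hdec : ∀ a : K0 (X × Y), ∃ α β : K0 X,
      a = pullback ContinuousMap.fst α + pullback ContinuousMap.fst β * pullback ContinuousMap.snd η) :
    Reduced (Collapse (X × Y) (prodWedgeC x₀ y₀)) (Collapse.pt (prodWedgeC x₀ y₀)) = ⊥ := by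
  rw [eq_bot_iff]
  intro b hb
  rw [AddSubgroup.mem_bot]
  obtain ⟨α, β, ha⟩ := hdec (quotK (prodWedgeC x₀ y₀) b)
  have hL := pullback_sliceLeft_quotK x₀ y₀ hb
  have hR := pullback_sliceRight_quotK x₀ y₀ hb
  rw [ha] at hL hR
  have h0 : quotK (prodWedgeC x₀ y₀) b = 0 := by
    rw [ha]; exact kunneth_decomp_eq_zero x₀ y₀ hX η hη α β hL hR
  exact eq_zero_of_quotK_prodWedge_eq_zero x₀ y₀ hb h0

end Collapse

/-! ### 3. Odd spheres, modulo the periodicity decomposition over `Sᵖ × S²` -/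

section Spheres

/-- **`K̃(Sᵖ) = 0 ⟹ K̃(Sᵖ⁺²) = 0`**, given the Bott decomposition of `K⁰(Sᵖ × S²)` over `1` and
`pr₂^* η` for a rank-one class `η ∈ K⁰(S²)` (the Hopf bundle): combine
`reduced_collapse_prodWedge_eq_bot_of_decomp` with `Sᵖ ∧ S² ≅ Sᵖ⁺²`
(`reduced_sphere_eq_bot_of_smash`). Base points are the poles `e_last`.
[cite: HusemollerFibreBundles1994, Ch. 11 Cor. 1.4, Thm. 5.5] -/
theorem reduced_sphere_add_two_eq_bot_of_decomp (p : ℕ)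
    (hp : Reduced (sphere (0 : EuclideanSpace ℝ (Fin (p + 1))) 1) (pole p) = ⊥)
    (η : K0 (sphere (0 : EuclideanSpace ℝ (Fin (2 + 1))) 1)) (hη : rankAt (pole 2) η = 1)
    (hdec : ∀ a : K0 (sphere (0 : EuclideanSpace ℝ (Fin (p + 1))) 1 × sphere (0 : EuclideanSpace ℝ (Fin (2 + 1))) 1),
      ∃ α β : K0 (sphere (0 : EuclideanSpace ℝ (Fin (p + 1))) 1),
        a = pullback ContinuousMap.fst α + pullback ContinuousMap.fst β * pullback ContinuousMap.snd η) :
    Reduced (sphere (0 : EuclideanSpace ℝ (Fin (p + 2 + 1))) 1) (pole (p + 2)) = ⊥ :=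
  reduced_sphere_eq_bot_of_smash p 2 (reduced_collapse_prodWedge_eq_bot_of_decomp (pole p) (pole 2) hp η hη hdec)

/-- **`K̃(S²ᵐ⁺¹) = 0` modulo Bott periodicity** (Husemöller, Ch. 11 Thm. 5.5 from Cor. 1.4 and
`K̃(S¹) = 0`): by induction on `m` from `reduced_sphere_one_eq_bot`, the step being
`reduced_sphere_add_two_eq_bot_of_decomp`; the hypotheses are a rank-one class `η ∈ K⁰(S²)` (the
Hopf bundle) and, for each `k < m`, the decomposition of `K⁰(S²ᵏ⁺¹ × S²)` over `1` and `pr₂^* η`.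
[cite: HusemollerFibreBundles1994, Ch. 11 Thm. 5.5] -/
theorem reduced_sphere_odd_eq_bot_of_decomp
    (η : K0 (sphere (0 : EuclideanSpace ℝ (Fin (2 + 1))) 1)) (hη : rankAt (pole 2) η = 1)
    (hdec : ∀ (k : ℕ) (a : K0 (sphere (0 : EuclideanSpace ℝ (Fin (2 * k + 1 + 1))) 1 × sphere (0 : EuclideanSpace ℝ (Fin (2 + 1))) 1)),
      ∃ α β : K0 (sphere (0 : EuclideanSpace ℝ (Fin (2 * k + 1 + 1))) 1),
        a = pullback ContinuousMap.fst α + pullback ContinuousMap.fst β * pullback ContinuousMap.snd η)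
    (m : ℕ) : Reduced (sphere (0 : EuclideanSpace ℝ (Fin (2 * m + 1 + 1))) 1) (pole (2 * m + 1)) = ⊥ := by
  induction m with
  | zero => exact reduced_sphere_one_eq_bot _
  | succ m ih => exact reduced_sphere_add_two_eq_bot_of_decomp (2 * m + 1) ih η hη (hdec m)

end Spheres

/-! ### 4. The Bott inputs: rank and naturality of `γ = [θ¹, z]`; `K̃(S²ᵐ⁺¹) = 0` -/

section Bott

variable {X : Type u} [TopologicalSpace X] [CompactSpace X] [T2Space X]

/-- **`[θ, g]` has rank `n` at every point** (its local models are the identity `n × n` matrices).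
[cite: HusemollerFibreBundles1994, Ch. 11 Notation 2.7] -/
theorem rankAt_bottClassGL {n : ℕ} (g : Matrix (Fin n) (Fin n) C(↥(pieceUp X ∩ pieceDn X), ℂ)) (hg : IsUnit g)
    (z : X × S2r) : rankAt z (bottClassGL g) = n := by
  obtain ⟨q, hq⟩ := exists_idem_isClutchedGL g hg
  rw [← hq.of_eq, rankAt_of]
  obtain ⟨w, -⟩ := hq
  have halg : AlgEquivalent (q.mat.map (evalRingHom z)) (1 : Matrix (Fin n) (Fin n) ℂ) := by
    have hz : z ∈ pieceUp X ∪ pieceDn X := by rw [pieceUp_union_pieceDn]; exact mem_univ z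
    rcases hz with hz | hz
    · have h := (w.algEquivalent₁).map (evalRingHom (⟨z, hz⟩ : ↥(pieceUp X)))
      rwa [map_resHom_map_evalRingHom, Matrix.map_one _ (map_zero _) (map_one _)] at h
    · have h := (w.algEquivalent₂).map (evalRingHom (⟨z, hz⟩ : ↥(pieceDn X)))
      rwa [map_resHom_map_evalRingHom, Matrix.map_one _ (map_zero _) (map_one _)] at h
  have hr : (q.map (evalRingHom z)).rank = n := Idem.rank_eq_iff.2 (Idem.equiv_iff.2 halg)
  rw [hr]

/-- `γ_X` has rank one everywhere. [cite: HusemollerFibreBundles1994, Ch. 11 Example 2.4] -/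
theorem rankAt_bottγ (z : X × S2r) : rankAt z (bottγ X) = 1 := by
  rw [bottγ, rankAt_bottClassGL _ (isUnit_smul_one isUnit_zA _) z, Nat.cast_one]

/-- **Naturality of the Bott class**: `(f × id)^* γ_X = γ_{X'}` (the clutching scalar `z` is pulled
back to itself). [cite: HusemollerFibreBundles1994, Ch. 11 Notation 2.7] -/
theorem pullback_baseMap_bottγ {X' : Type v} [TopologicalSpace X'] [CompactSpace X'] [T2Space X'] (f : C(X', X)) :
    pullback (baseMap f) (bottγ X) = bottγ X' := by
  rw [bottγ, pullback_baseMap_bottClassGL _ (isUnit_smul_one isUnit_zA _) f, bottγ]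
  congr 1
  rw [Matrix.map_smul' _ _ _ (map_mul _), Matrix.map_one _ (map_zero _) (map_one _)]
  rfl

/-- **The Bott class on `S²` itself**, `γ₀ = j^* γ_{pt} ∈ K⁰(S²)` for `j : S² ≅ pt × S²`, pulls
back to `γ_X` along `pr₂`: `pr₂^* γ₀ = γ_X`. [cite: HusemollerFibreBundles1994, Ch. 11 Notation 2.7] -/
theorem pullback_snd_bottγ_unit (X : Type u) [TopologicalSpace X] [CompactSpace X] [T2Space X] :
    pullback (ContinuousMap.snd : C(X × S2r, S2r))
        (pullback ((ContinuousMap.const S2r ()).prodMk (ContinuousMap.id S2r)) (bottγ Unit)) = bottγ X := by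
  rw [← AddMonoidHom.comp_apply, ← pullback_comp]
  have h : ((ContinuousMap.const S2r ()).prodMk (ContinuousMap.id S2r)).comp (ContinuousMap.snd : C(X × S2r, S2r)) =
      baseMap (ContinuousMap.const X ()) := by
    ext ⟨x, s⟩ : 1; rfl
  rw [h, pullback_baseMap_bottγ]

/-- `γ₀` has rank one everywhere. [cite: HusemollerFibreBundles1994, Ch. 11 Example 2.4] -/
theorem rankAt_bottγ_unit (s : S2r) :
    rankAt s (pullback ((ContinuousMap.const S2r ()).prodMk (ContinuousMap.id S2r)) (bottγ Unit)) = 1 := by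
  rw [rankAt_pullback, rankAt_bottγ]

/-- **`K̃(S²ᵐ⁺¹) = 0`** (reduced complex `K`-theory of odd spheres vanishes; Husemöller, Ch. 11
Thm. 5.5; equivalently Bott's `π_{2m}(U) = 0`), at the pole `e_last`: `reduced_sphere_odd_eq_bot_of_decomp`
fed with the Bott class `γ₀ = j^* γ_{pt} ∈ K⁰(S²)` and the surjectivity half of Bott periodicity
`bott_surjective` for `X = S²ᵏ⁺¹`. [cite: HusemollerFibreBundles1994, Ch. 11 Thm. 5.5] -/
theorem reduced_sphere_odd_eq_bot (m : ℕ) :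
    Reduced (sphere (0 : EuclideanSpace ℝ (Fin (2 * m + 1 + 1))) 1) (pole (2 * m + 1)) = ⊥ := by
  refine reduced_sphere_odd_eq_bot_of_decomp _ (rankAt_bottγ_unit _) (fun k a ↦ ?_) m
  obtain ⟨α, β, h⟩ := bott_surjective (X := sphere (0 : EuclideanSpace ℝ (Fin (2 * k + 1 + 1))) 1) a
  refine ⟨α, β, h.trans ?_⟩
  rw [pullback_snd_bottγ_unit]

/-- **`K̃(S⁷) = 0`** at the pole (the case used for Bott's `π₆(U) = 0`, `π₆(SO(8)) = 0`).
[cite: HusemollerFibreBundles1994, Ch. 11 Thm. 5.5] -/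
theorem reduced_sphere_seven_eq_bot : Reduced (sphere (0 : EuclideanSpace ℝ (Fin 8)) 1) (pole 7) = ⊥ :=
  reduced_sphere_odd_eq_bot 3

end Bott

end Literature.AlgebraicTopology.KTheory

end
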